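import Summits.Ventures.PercRepro.C041PendantZone
import Summits.Ventures.PercRepro.C041ZoneOCubeOneSided

/-!
# ROW C-041 — the zone sets of a pendant attachment (p6, gen 29; C-041.md §20 (b), THEOREM (PENDANT ZONE))

Setting of `C041PendantZone`: `pendant Z₁ u Z₂ a₂`, a state `σ` with `colL σ` (the colouring of `Z₁`) and
`restr σ` (the state of `Z₂`).  The marks are `Z₂`'s, redirected (`inl_mem_Bl_iff`, `inr_mem_Bl_iff`, …); from the
reach lemmas: `inl v ∈ D ⟺ a₂ ∈ D₂ ∧ v ~ u` (`inl_mem_D_iff`), `inr x ∈ D ⟺ x ≠ a₂ ∧ x ∈ D₂` (`inr_mem_D_iff`), the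
same for `D2`; so for the anchor `a` of `Z₁`: `inl a ∈ D ⟺ a₂ ∈ D₂ ∧ Mg` (`inl_a_mem_D_iff`), `inl a ∈ D2 ⟺ a₂ ∈
D2₂ ∧ Mg` (`inl_a_mem_D2_iff`), ADMISSIBILITY IS `Z₂`'s (`adm_iff`: `Z₁` carries no mark) and «blue at `K`» is
`Rd → blueK₂ {a₂}` (`blueK_iff`) — with `Mg` / `Rd` = «`u` merged into / reached by `a` inside `Z₁`»
(`C041ZoneOneVertexDefs`).
-/

namespace PercRepro

namespace ZoneZ

namespace Pendant

open ZoneData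

universe u₁ u₂ u₃ u₄ u₅ u₆ u₇ u₈

variable {V₁ : Type u₁} {E₁ : Type u₂} {U₁ : Type u₃} {U₂ : Type u₄} {V₂ : Type u₅} {E₂ : Type u₆}
  {T₁ : Type u₇} {T₂ : Type u₈}

/-! ## Two reach lemmas -/

/-- A point is reached from `B` iff it lies in `B` or is reached from `B` without it. -/
theorem mem_reach_self_iff_avoid {V : Type*} (R : V → V → Prop) (B : Set V) (a : V) :
    a ∈ reach R B ↔ a ∈ B ∨ a ∈ reach R {y | y ≠ a ∧ y ∈ B} := by
  constructor
  · rintro ⟨s, hs, hsa⟩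
    by_cases h : s = a
    · exact Or.inl (h ▸ hs)
    · exact Or.inr ⟨s, ⟨h, hs⟩, hsa⟩
  · rintro (h | h)
    · exact mem_reach_of_mem h
    · exact reach_mono (fun _ _ h => h) (fun y hy => hy.2) h

/-- A vertex is reached from `B` iff it is reached from `B` without `a`, or `a` is reached from `B` and it is
reached from `a`. -/
theorem mem_reach_iff_avoid {V : Type*} (R : V → V → Prop) (B : Set V) (a x : V) :
    x ∈ reach R B ↔ x ∈ reach R {y | y ≠ a ∧ y ∈ B} ∨ (a ∈ reach R B ∧ x ∈ reach R {a}) := by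
  constructor
  · rintro ⟨s, hs, hsx⟩
    by_cases h : s = a
    · subst h
      exact Or.inr ⟨mem_reach_of_mem hs, ⟨s, rfl, hsx⟩⟩
    · exact Or.inl ⟨s, ⟨h, hs⟩, hsx⟩
  · rintro (h | ⟨ha, hx⟩)
    · exact reach_mono (fun _ _ h => h) (fun y hy => hy.2) h
    · obtain ⟨s, hs, hsx⟩ := hx
      rw [Set.mem_singleton_iff] at hs
      rw [hs] at hsx
      exact reach_trans ha hsx

/-- The reach of a conditional singleton `{v | v = u ∧ P}`. -/
theorem mem_reach_condSingleton {V : Type*} (R : V → V → Prop) (u x : V) (P : Prop) :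
    x ∈ reach R {v | v = u ∧ P} ↔ P ∧ x ∈ reach R {u} := by
  constructor
  · rintro ⟨s, ⟨hs, hP⟩, hsx⟩
    rw [hs] at hsx
    exact ⟨hP, u, rfl, hsx⟩
  · rintro ⟨hP, s, hs, hsx⟩
    rw [Set.mem_singleton_iff] at hs
    rw [hs] at hsx
    exact ⟨u, ⟨rfl, hP⟩, hsx⟩

variable (Z₁ : ZoneData V₁ E₁ U₁ U₂) (u : V₁) (Z₂ : ZoneData V₂ E₂ T₁ T₂) (a₂ : V₂) (σ : State (E₁ ⊕ E₂) T₁ T₂)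

/-! ## Marks -/

/-- A redirected mark set at a `Z₁`-vertex: only the junction, carrying `a₂`'s marks. -/
theorem inl_mem_markSet_red {T : Type*} (at_ : T → V₂) (m : T → Bool) (b : Bool) (v : V₁) :
    Sum.inl v ∈ markSet (fun t => red u a₂ (at_ t)) m b ↔ v = u ∧ a₂ ∈ markSet at_ m b := by
  unfold markSet
  constructor
  · rintro ⟨t, ht, hm⟩
    obtain ⟨h1, h2⟩ := eq_of_red_eq_inl ht
    exact ⟨h2, t, h1, hm⟩
  · rintro ⟨rfl, t, ht, hm⟩
    exact ⟨t, by simp only [ht, red_self], hm⟩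

/-- A redirected mark set at a `Z₂`-vertex: the vertex's marks, if it is not the anchor. -/
theorem inr_mem_markSet_red {T : Type*} (at_ : T → V₂) (m : T → Bool) (b : Bool) (x : V₂) :
    Sum.inr x ∈ markSet (fun t => red u a₂ (at_ t)) m b ↔ x ≠ a₂ ∧ x ∈ markSet at_ m b := by
  unfold markSet
  constructor
  · rintro ⟨t, ht, hm⟩
    obtain ⟨h1, h2⟩ := eq_of_red_eq_inr ht
    rw [h2] at h1
    exact ⟨h1, t, h2, hm⟩
  · rintro ⟨hx, t, ht, hm⟩
    exact ⟨t, by simp only [ht, red_of_ne u hx], hm⟩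

/-- `Bl` at a `Z₁`-vertex. -/
theorem inl_mem_Bl_iff (v : V₁) :
    Sum.inl v ∈ (pendant Z₁ u Z₂ a₂).Bl σ ↔ v = u ∧ a₂ ∈ Z₂.Bl (restr σ) :=
  inl_mem_markSet_red u a₂ Z₂.at₁ σ.2.1 false v
/-- `Bl` at a `Z₂`-vertex. -/
theorem inr_mem_Bl_iff (x : V₂) :
    Sum.inr x ∈ (pendant Z₁ u Z₂ a₂).Bl σ ↔ x ≠ a₂ ∧ x ∈ Z₂.Bl (restr σ) :=
  inr_mem_markSet_red u a₂ Z₂.at₁ σ.2.1 false x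
/-- `Blt` at a `Z₁`-vertex. -/
theorem inl_mem_Blt_iff (v : V₁) :
    Sum.inl v ∈ (pendant Z₁ u Z₂ a₂).Blt σ ↔ v = u ∧ a₂ ∈ Z₂.Blt (restr σ) :=
  inl_mem_markSet_red u a₂ Z₂.at₁ σ.2.1 true v
/-- `Blt` at a `Z₂`-vertex. -/
theorem inr_mem_Blt_iff (x : V₂) :
    Sum.inr x ∈ (pendant Z₁ u Z₂ a₂).Blt σ ↔ x ≠ a₂ ∧ x ∈ Z₂.Blt (restr σ) :=
  inr_mem_markSet_red u a₂ Z₂.at₁ σ.2.1 true x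
/-- `M` at a `Z₁`-vertex. -/
theorem inl_mem_M_iff (v : V₁) :
    Sum.inl v ∈ (pendant Z₁ u Z₂ a₂).M σ ↔ v = u ∧ a₂ ∈ Z₂.M (restr σ) :=
  inl_mem_markSet_red u a₂ Z₂.at₂ σ.2.2 false v
/-- `M` at a `Z₂`-vertex. -/
theorem inr_mem_M_iff (x : V₂) :
    Sum.inr x ∈ (pendant Z₁ u Z₂ a₂).M σ ↔ x ≠ a₂ ∧ x ∈ Z₂.M (restr σ) :=
  inr_mem_markSet_red u a₂ Z₂.at₂ σ.2.2 false x
/-- `Mt` at a `Z₁`-vertex. -/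
theorem inl_mem_Mt_iff (v : V₁) :
    Sum.inl v ∈ (pendant Z₁ u Z₂ a₂).Mt σ ↔ v = u ∧ a₂ ∈ Z₂.Mt (restr σ) :=
  inl_mem_markSet_red u a₂ Z₂.at₂ σ.2.2 true v
/-- `Mt` at a `Z₂`-vertex. -/
theorem inr_mem_Mt_iff (x : V₂) :
    Sum.inr x ∈ (pendant Z₁ u Z₂ a₂).Mt σ ↔ x ≠ a₂ ∧ x ∈ Z₂.Mt (restr σ) :=
  inr_mem_markSet_red u a₂ Z₂.at₂ σ.2.2 true x

/-- The stray vertex carries no mark. -/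
theorem stray_not_mem_markSet_red {T : Type*} (at_ : T → V₂) (m : T → Bool) (b : Bool) :
    Sum.inr a₂ ∉ markSet (fun t => red u a₂ (at_ t)) m b := by
  rw [inr_mem_markSet_red]
  exact fun h => h.1 rfl

/-! ## The deleted vertices (either side) -/

/-- The reach from a redirected mark set, the generic form: the junction condition is «`a₂` is reached inside `Z₂`
from the marks». -/
theorem junction_markSet_iff (c : Bool) {T : Type*} (at_ : T → V₂) (m : T → Bool) (b : Bool) :
    junction Z₁ u Z₂ a₂ c σ (markSet (fun t => red u a₂ (at_ t)) m b) ↔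
      a₂ ∈ reach (cAdj Z₂ c (restr σ).1) (markSet at_ m b) := by
  unfold junction
  have e1 : leftSet (markSet (fun t => red u a₂ (at_ t)) m b) = {v | v = u ∧ a₂ ∈ markSet at_ m b} := by
    ext v
    exact inl_mem_markSet_red u a₂ at_ m b v
  have e2 : rightSet (markSet (fun t => red u a₂ (at_ t)) m b) = {x | x ≠ a₂ ∧ x ∈ markSet at_ m b} := by
    ext x
    exact inr_mem_markSet_red u a₂ at_ m b x
  rw [e1, e2, mem_reach_condSingleton, mem_reach_self_iff_avoid (cAdj Z₂ c (restr σ).1) (markSet at_ m b) a₂]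
  constructor
  · rintro (⟨h, -⟩ | h)
    · exact Or.inl h
    · exact Or.inr h
  · rintro (h | h)
    · exact Or.inl ⟨h, mem_reach_of_mem rfl⟩
    · exact Or.inr h

/-- A `Z₁`-vertex is reached from a redirected mark set iff `a₂` is reached inside `Z₂` from the marks and the
vertex is connected to `u` inside `Z₁`. -/
theorem inl_mem_reach_markSet_iff (c : Bool) {T : Type*} (at_ : T → V₂) (m : T → Bool) (b : Bool) (v : V₁) :
    Sum.inl v ∈ reach (cAdj (pendant Z₁ u Z₂ a₂) c σ.1) (markSet (fun t => red u a₂ (at_ t)) m b) ↔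
      a₂ ∈ reach (cAdj Z₂ c (restr σ).1) (markSet at_ m b) ∧ v ∈ reach (cAdj Z₁ c (colL σ)) {u} := by
  rw [inl_mem_reach_iff Z₁ u Z₂ a₂ c σ _ (stray_not_mem_markSet_red u a₂ at_ m b), junction_markSet_iff]
  have e1 : leftSet (markSet (fun t => red u a₂ (at_ t)) m b) = {v | v = u ∧ a₂ ∈ markSet at_ m b} := by
    ext v
    exact inl_mem_markSet_red u a₂ at_ m b v
  rw [e1, mem_reach_condSingleton]
  constructor
  · rintro (⟨h1, h2⟩ | h)
    · exact ⟨mem_reach_of_mem h1, h2⟩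
    · exact h
  · intro h
    exact Or.inr h

/-- A `Z₂`-vertex is reached from a redirected mark set iff it is not the stray vertex and is reached inside `Z₂`
from the marks. -/
theorem inr_mem_reach_markSet_iff (c : Bool) {T : Type*} (at_ : T → V₂) (m : T → Bool) (b : Bool) (x : V₂) :
    Sum.inr x ∈ reach (cAdj (pendant Z₁ u Z₂ a₂) c σ.1) (markSet (fun t => red u a₂ (at_ t)) m b) ↔
      x ≠ a₂ ∧ x ∈ reach (cAdj Z₂ c (restr σ).1) (markSet at_ m b) := by
  rw [inr_mem_reach_iff Z₁ u Z₂ a₂ c σ _ (stray_not_mem_markSet_red u a₂ at_ m b), junction_markSet_iff]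
  have e2 : rightSet (markSet (fun t => red u a₂ (at_ t)) m b) = {x | x ≠ a₂ ∧ x ∈ markSet at_ m b} := by
    ext x
    exact inr_mem_markSet_red u a₂ at_ m b x
  rw [e2, ← mem_reach_iff_avoid (cAdj Z₂ c (restr σ).1) (markSet at_ m b) a₂ x]

/-- A `Z₁`-vertex is deleted iff `a₂` is deleted in `Z₂` and the vertex lies in the blue component of `u`. -/
theorem inl_mem_D_iff (v : V₁) :
    Sum.inl v ∈ (pendant Z₁ u Z₂ a₂).D σ ↔ a₂ ∈ Z₂.D (restr σ) ∧ v ∈ reach (cAdj Z₁ false (colL σ)) {u} :=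
  inl_mem_reach_markSet_iff Z₁ u Z₂ a₂ σ false Z₂.at₁ σ.2.1 false v

/-- A `Z₂`-vertex is deleted iff it is not the stray vertex and is deleted in `Z₂`. -/
theorem inr_mem_D_iff (x : V₂) :
    Sum.inr x ∈ (pendant Z₁ u Z₂ a₂).D σ ↔ x ≠ a₂ ∧ x ∈ Z₂.D (restr σ) :=
  inr_mem_reach_markSet_iff Z₁ u Z₂ a₂ σ false Z₂.at₁ σ.2.1 false x

/-- A `Z₁`-vertex is deleted on side `2` iff `a₂` is and the vertex lies in the blue component of `u`. -/
theorem inl_mem_D2_iff (v : V₁) :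
    Sum.inl v ∈ (pendant Z₁ u Z₂ a₂).D2 σ ↔ a₂ ∈ Z₂.D2 (restr σ) ∧ v ∈ reach (cAdj Z₁ false (colL σ)) {u} :=
  inl_mem_reach_markSet_iff Z₁ u Z₂ a₂ σ false Z₂.at₂ σ.2.2 false v

/-- A `Z₂`-vertex is deleted on side `2` iff it is not the stray vertex and is so in `Z₂`. -/
theorem inr_mem_D2_iff (x : V₂) :
    Sum.inr x ∈ (pendant Z₁ u Z₂ a₂).D2 σ ↔ x ≠ a₂ ∧ x ∈ Z₂.D2 (restr σ) :=
  inr_mem_reach_markSet_iff Z₁ u Z₂ a₂ σ false Z₂.at₂ σ.2.2 false x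

/-! ## The anchor of `Z₁` -/

variable (a : V₁)

/-- **The anchor is deleted** iff `a₂` is deleted in `Z₂` and `u` is merged into the anchor's blue sub-zone. -/
theorem inl_a_mem_D_iff :
    Sum.inl a ∈ (pendant Z₁ u Z₂ a₂).D σ ↔ a₂ ∈ Z₂.D (restr σ) ∧ Z₁.Mg a u (colL σ) := by
  rw [inl_mem_D_iff]
  unfold Mg
  rw [← cAdj_false]
  exact and_congr Iff.rfl ⟨fun h => mem_reach_singleton_symm (cAdj_symm Z₁ false (colL σ)) h,
    fun h => mem_reach_singleton_symm (cAdj_symm Z₁ false (colL σ)) h⟩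

/-- **The anchor is deleted on side `2`** iff `a₂` is and `u` is merged. -/
theorem inl_a_mem_D2_iff :
    Sum.inl a ∈ (pendant Z₁ u Z₂ a₂).D2 σ ↔ a₂ ∈ Z₂.D2 (restr σ) ∧ Z₁.Mg a u (colL σ) := by
  rw [inl_mem_D2_iff]
  unfold Mg
  rw [← cAdj_false]
  exact and_congr Iff.rfl ⟨fun h => mem_reach_singleton_symm (cAdj_symm Z₁ false (colL σ)) h,
    fun h => mem_reach_singleton_symm (cAdj_symm Z₁ false (colL σ)) h⟩

/-- **Admissibility is `Z₂`'s**: `Z₁` carries no mark. -/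
theorem adm_iff : (pendant Z₁ u Z₂ a₂).adm σ ↔ Z₂.adm (restr σ) := by
  unfold adm
  rw [Set.disjoint_left, Set.disjoint_left]
  constructor
  · intro h x hxM hxD
    by_cases hx : x = a₂
    · subst hx
      exact h ((inl_mem_M_iff Z₁ u Z₂ x σ u).2 ⟨rfl, hxM⟩)
        ((inl_mem_D_iff Z₁ u Z₂ x σ u).2 ⟨hxD, mem_reach_of_mem rfl⟩)
    · exact h ((inr_mem_M_iff Z₁ u Z₂ a₂ σ x).2 ⟨hx, hxM⟩) ((inr_mem_D_iff Z₁ u Z₂ a₂ σ x).2 ⟨hx, hxD⟩)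
  · intro h w hwM hwD
    rcases w with v | x
    · obtain ⟨-, hM⟩ := (inl_mem_M_iff Z₁ u Z₂ a₂ σ v).1 hwM
      obtain ⟨hD, -⟩ := (inl_mem_D_iff Z₁ u Z₂ a₂ σ v).1 hwD
      exact h hM hD
    · obtain ⟨-, hM⟩ := (inr_mem_M_iff Z₁ u Z₂ a₂ σ x).1 hwM
      obtain ⟨-, hD⟩ := (inr_mem_D_iff Z₁ u Z₂ a₂ σ x).1 hwD
      exact h hM hD

/-- The junction condition for the source `{inl a}` is «`u` is connected to `a` inside `Z₁`». -/
theorem junction_singleton_iff (c : Bool) :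
    junction Z₁ u Z₂ a₂ c σ {Sum.inl a} ↔ u ∈ reach (cAdj Z₁ c (colL σ)) {a} := by
  unfold junction
  have e1 : leftSet ({Sum.inl a} : Set (V₁ ⊕ V₂)) = {a} := by
    ext v
    simp [leftSet]
  have e2 : rightSet ({Sum.inl a} : Set (V₁ ⊕ V₂)) = ∅ := by
    ext x
    simp [rightSet]
  rw [e1, e2, reach_empty]
  simp only [Set.mem_empty_iff_false, or_false]

/-- The stray vertex is not the anchor. -/
theorem stray_not_mem_singleton : Sum.inr a₂ ∉ ({Sum.inl a} : Set (V₁ ⊕ V₂)) := by simp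

/-- A `Z₂`-vertex lies in the red reach of the anchor iff it is not the stray vertex, `u` is reached and it lies in
the red reach of `a₂` inside `Z₂`. -/
theorem inr_mem_K_iff (x : V₂) :
    Sum.inr x ∈ (pendant Z₁ u Z₂ a₂).K {Sum.inl a} σ ↔
      x ≠ a₂ ∧ (Z₁.Rd a u (colL σ) ∧ x ∈ Z₂.K {a₂} (restr σ)) := by
  unfold K RedAdj
  rw [adj_eq_cAdj, inr_mem_reach_iff Z₁ u Z₂ a₂ true σ _ (stray_not_mem_singleton a₂ a), junction_singleton_iff]
  have e2 : rightSet ({Sum.inl a} : Set (V₁ ⊕ V₂)) = ∅ := by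
    ext x
    simp [rightSet]
  rw [e2, reach_empty]
  simp only [Set.mem_empty_iff_false, false_or]
  rfl

/-- The junction lies in the red reach of the anchor iff `u` is reached. -/
theorem inl_u_mem_K_iff : Sum.inl u ∈ (pendant Z₁ u Z₂ a₂).K {Sum.inl a} σ ↔ Z₁.Rd a u (colL σ) := by
  unfold K RedAdj
  rw [adj_eq_cAdj, inl_mem_reach_iff Z₁ u Z₂ a₂ true σ _ (stray_not_mem_singleton a₂ a), junction_singleton_iff]
  have e1 : leftSet ({Sum.inl a} : Set (V₁ ⊕ V₂)) = {a} := by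
    ext v
    simp [leftSet]
  rw [e1]
  constructor
  · rintro (h | ⟨h, -⟩)
    · exact h
    · exact h
  · intro h
    exact Or.inl h

/-- **Blue at `K`**: if `u` is reached then `Z₂` is blue at its own `K`. -/
theorem blueK_iff :
    (pendant Z₁ u Z₂ a₂).blueK {Sum.inl a} σ ↔ (Z₁.Rd a u (colL σ) → Z₂.blueK {a₂} (restr σ)) := by
  unfold blueK
  rw [Set.disjoint_left]
  constructor
  · intro h hRd
    rw [Set.disjoint_left]
    intro x hxK hxM
    by_cases hx : x = a₂
    · subst hx
      refine h ((inl_u_mem_K_iff Z₁ u Z₂ x σ a).2 hRd) ?_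
      rcases hxM with hm | hm
      · exact Or.inl ((inl_mem_Blt_iff Z₁ u Z₂ x σ u).2 ⟨rfl, hm⟩)
      · exact Or.inr ((inl_mem_Mt_iff Z₁ u Z₂ x σ u).2 ⟨rfl, hm⟩)
    · refine h ((inr_mem_K_iff Z₁ u Z₂ a₂ σ a x).2 ⟨hx, hRd, hxK⟩) ?_
      rcases hxM with hm | hm
      · exact Or.inl ((inr_mem_Blt_iff Z₁ u Z₂ a₂ σ x).2 ⟨hx, hm⟩)
      · exact Or.inr ((inr_mem_Mt_iff Z₁ u Z₂ a₂ σ x).2 ⟨hx, hm⟩)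
  · intro h w hwK hwM
    rcases w with v | x
    · have hvu : v = u := by
        rcases hwM with hm | hm
        · exact ((inl_mem_Blt_iff Z₁ u Z₂ a₂ σ v).1 hm).1
        · exact ((inl_mem_Mt_iff Z₁ u Z₂ a₂ σ v).1 hm).1
      subst hvu
      have hRd := (inl_u_mem_K_iff Z₁ v Z₂ a₂ σ a).1 hwK
      refine Set.disjoint_left.1 (h hRd) (mem_reach_of_mem rfl) ?_
      rcases hwM with hm | hm
      · exact Or.inl ((inl_mem_Blt_iff Z₁ v Z₂ a₂ σ v).1 hm).2
      · exact Or.inr ((inl_mem_Mt_iff Z₁ v Z₂ a₂ σ v).1 hm).2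
    · obtain ⟨hx, hRd, hxK⟩ := (inr_mem_K_iff Z₁ u Z₂ a₂ σ a x).1 hwK
      refine Set.disjoint_left.1 (h hRd) hxK ?_
      rcases hwM with hm | hm
      · exact Or.inl ((inr_mem_Blt_iff Z₁ u Z₂ a₂ σ x).1 hm).2
      · exact Or.inr ((inr_mem_Mt_iff Z₁ u Z₂ a₂ σ x).1 hm).2

end Pendant

end ZoneZ

end PercRepro
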